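import Literature.AlgebraicTopology.SingularHomology.KroneckerInjective
import Literature.AlgebraicTopology.SingularHomology.ExcisionMayerVietorisProofs
import Literature.AlgebraicTopology.SingularHomology.PuncturedEuclidean
import Literature.AlgebraicTopology.SingularHomology.CohomologyHomotopyInvariance
import Mathlib.LinearAlgebra.Complex.FiniteDimensional
import HarnessLib

/-!
# `H²(𝕊³; R) = 0` and `H²(ℂ² ∖ 0; R) = 0` over a principal ideal domain

A. Hatcher, *Algebraic Topology* (2002), Cor. 2.14 (`H_k(𝕊ⁿ) = 0` for `k ≠ 0, n`) with the
universal coefficient theorem Thm. 3.2 (p. 195): `H²(𝕊³; R) ↪ Hom(H₂(𝕊³; R), R) = 0` since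
`H₁(𝕊³; R) = 0` (the tree's `kroneckerPairing_injective_of_isZero`) — so **`H²(𝕊³; R) = 0`**
(`isZero_singularCohomology_sphere_three_two`); and `ℂ² ∖ 0 ≃ₜ ℝ⁴ ∖ 0 ≃ 𝕊³` (a real-linear
isomorphism `ℂ × ℂ ≅ ℝ⁴` and the radial retraction `PuncturedEuclidean.sphereHomotopyEquivPunctured`),
so **`H²(ℂ² ∖ 0; R) = 0`** (`isZero_singularCohomology_puncturedPlane_two`). This is the
vanishing that makes the Euler class of the tautological line bundle over `ℂP¹` a generator
(Milnor–Stasheff §14, Thm. 14.4 via the Gysin sequence of `γ¹`, `E₀(γ¹) ≅ ℂ² ∖ 0`).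

Everything is proved; no named facts.

## References

* A. Hatcher, *Algebraic Topology*, CUP 2002, Cor. 2.14, §3.1 Thm. 3.2. [HatcherAT2002]
* J. Milnor, J. Stasheff, *Characteristic Classes*, PUP 1974, §14 Thm. 14.4. [MilnorStasheff1974]
-/

noncomputable section

open CategoryTheory CategoryTheory.Limits Set

namespace Literature.AlgebraicTopology.SingularHomology

variable (R : Type) [CommRing R] [IsDomain R] [IsPrincipalIdealRing R]

/-- **`H²(𝕊³; R) = 0`** (`𝕊³ ⊆ ℝ⁴` the unit sphere): `H₁(𝕊³) = 0` makes the Kronecker map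
`H² → Hom(H₂, R)` injective, and `H₂(𝕊³) = 0`. [cite: HatcherAT2002, Cor. 2.14 and Thm. 3.2] -/
theorem isZero_singularCohomology_sphere_three_two :
    IsZero (singularCohomology R R (Metric.sphere (0 : EuclideanSpace ℝ (Fin (3 + 1))) 1) 2) := by
  have h1 : IsZero (singularHomology R R (Metric.sphere (0 : EuclideanSpace ℝ (Fin (3 + 1))) 1) 1) :=
    isZero_singularHomology_sphere_holds R R one_ne_zero (by norm_num)
  have h2 : IsZero (singularHomology R R (Metric.sphere (0 : EuclideanSpace ℝ (Fin (3 + 1))) 1) 2) :=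
    isZero_singularHomology_sphere_holds R R two_ne_zero (by norm_num)
  have hinj := kroneckerPairing_injective_of_isZero R _ 1 h1
  haveI : Subsingleton (singularHomology R R (Metric.sphere (0 : EuclideanSpace ℝ (Fin (3 + 1))) 1) 2) :=
    ModuleCat.subsingleton_of_isZero h2
  haveI : Subsingleton (singularCohomology R R (Metric.sphere (0 : EuclideanSpace ℝ (Fin (3 + 1))) 1) 2) :=
    ⟨fun x y ↦ hinj (Subsingleton.elim _ _)⟩
  exact ModuleCat.isZero_of_subsingleton _

/-- **`H²(ℝ⁴ ∖ 0; R) = 0`**: `ℝ⁴ ∖ 0 ≃ 𝕊³`. [cite: HatcherAT2002, Cor. 2.14 and Thm. 3.2] -/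
theorem isZero_singularCohomology_punctured_four_two : IsZero (singularCohomology R R ↥(punctured 4) 2) :=
  (isZero_singularCohomology_sphere_three_two R).of_iso
    (singularCohomology.isoOfHomotopyEquiv' R R (sphereHomotopyEquivPunctured 4) 2)

/-- A real-linear homeomorphism `ℂ × ℂ ≃ ℝ⁴`. [folklore] -/
def complexPlaneEquivRVec : (ℂ × ℂ) ≃L[ℝ] RVec 4 :=
  ContinuousLinearEquiv.ofFinrankEq (by rw [Module.finrank_prod, Complex.finrank_real_complex, Module.finrank_fin_fun])

/-- **`ℂ² ∖ 0 ≃ₜ ℝ⁴ ∖ 0`.** [folklore] -/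
def puncturedPlaneHomeomorph : {p : ℂ × ℂ // p ≠ 0} ≃ₜ ↥(punctured 4) :=
  (complexPlaneEquivRVec.toHomeomorph).subtype fun p ↦ by
    change p ≠ 0 ↔ complexPlaneEquivRVec p ∈ punctured 4
    rw [punctured, mem_setOf_eq, complexPlaneEquivRVec.toLinearEquiv.map_ne_zero_iff.symm]
    rfl

/-- **`H²(ℂ² ∖ 0; R) = 0`.** [cite: MilnorStasheff1974, §14 Thm. 14.4] -/
theorem isZero_singularCohomology_puncturedPlane_two :
    IsZero (singularCohomology R R {p : ℂ × ℂ // p ≠ 0} 2) :=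
  (isZero_singularCohomology_punctured_four_two R).of_iso
    (singularCohomology.mapIso R R puncturedPlaneHomeomorph 2).symm

end Literature.AlgebraicTopology.SingularHomology
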